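import Mathlib.Analysis.Polynomial.Basic
import Literature.NumberTheory.Sieve.PolynomialValuesSieveSequence
import Literature.NumberTheory.Sieve.SieveFrameworkProofs
import Literature.NumberTheory.Sieve.MoebiusShiftedPrimesSieveBound
import Literature.NumberTheory.LFunctions.LogIntegralProofs
import Literature.NumberTheory.Sieve.AletheiaZomleferFukshanskyGarcia2020Applications
import Literature.Barriers.Parity.UniformBatemanHornBunyakovsky
import HarnessLib

/-!
# Aletheia-Zomlefer–Fukshansky–Garcia (2020), §3.6: the Brun-sieve upper bound — proof

Topic `Literature/NumberTheory/Sieve`, companion ("Proofs") file of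
`AletheiaZomleferFukshanskyGarcia2020Applications.lean` (kept separate because of the heavy sieve
imports). It DISCHARGES the named fact
`Literature.NumberTheory.Sieve.polyPrimeCount_le_brunSieve` of that file:

  for every `k` and degrees `d : Fin k → ℕ` there is `B` such that for every Bateman–Horn system
  `f` with `deg fᵢ = dᵢ` and every `C` with `HasBatemanHornConst f C`, eventually in `x : ℕ`,
  `Q(f; x) ≤ B · C/(∏ dᵢ) · ∫₂ˣ dt/(log t)^k`

— the display after (3.6.3) in §3.6 of S. L. Aletheia-Zomlefer, L. Fukshansky, S. R. Garcia,
*The Bateman–Horn conjecture: heuristics, history, and applications*, Expo. Math. 38 (2020)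
= arXiv:1807.08899v4, p. 10: "The Brun sieve provides a constant `B` that depends only on `k` and
the degrees of the polynomials involved such that `Q(f₁,…,f_k; x) ≤ B C(f₁,…,f_k)/(∏ deg fᵢ) ·
∫₂ˣ dt/(log t)^k` for sufficiently large `x` [81, Thm. 3, Sect. I.4.2]" (`[81]` = Tenenbaum,
*Introduction to analytic and probabilistic number theory*). Everything here is PROVED from the
tree; no definition and no new fact is introduced.

## The argument (`polyPrimeCount_le_brunSieve_holds`)

The classical upper-bound sieve for polynomial sequences (Halberstam–Richert, *Sieve Methods*,
Thm 5.3 / Tenenbaum §I.4.2 Thm 3), run through the tree's PROVED Fundamental Lemma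
`SieveSequence.fundamental_lemma_uniform_holds` (`SieveFrameworkFundamentalLemma.lean`) and the
sifted sequence of polynomial values `polyAPSeq` (`PolynomialValuesSieveSequence.lean`):

1. (`PolyPrimeCountBrun.polyPrimeCount_le_card_coprime_add`) choose `n₀` with `fᵢ(n) ≥ 1` for
   `n ≥ n₀` (positive leading coefficients, positive degrees;
   `Literature.Barriers.Parity.exists_forall_le_eval_of_leadingCoeff_pos`) and put
   `F(t) = ∏ᵢ fᵢ(t + n₀)`;
   then `Q(f; N) ≤ (n₀ + 1) + #{1 ≤ m ≤ N : (F(m), P(z)) = 1} + (∑ deg fᵢ)(z + 1)` (an `n` with all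
   `fᵢ(n)` prime and `≥ z` gives `F(n − n₀)` free of primes `< z`; each `fᵢ` takes each of the
   `< z + 1` small values at most `deg fᵢ` times).
2. (`PolyPrimeCountBrun.hasSieveDimension_rootDensity_of_le`) `ω_F(p) = ω_f(p)` (translation
   invariance, `Literature.Barriers.Parity.polyRootCountMod_comp_X_add_C`), `ω_F(p) ≤ ∑ deg fᵢ =: D`
   (Lagrange, as `F mod p ≠ 0` by `ω(p) < p`) and `ω_F(p) < p`,
   so the multiplicative density `ω_F(m)/m` has sieve dimension `2D` with a constant depending on
   `D` only (Mertens over windows, `sum_primesWindow_one_div_le`).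
3. (`PolyPrimeCountBrun.card_coprime_le_of_fundamentalLemma`) the Fundamental Lemma with level
   `z` (`s = 1`) and the remainder bound `|R_m| ≤ ω_F(m) ≤ m` give
   `#{1 ≤ m ≤ N : (F(m), P(z)) = 1} ≤ (1 + C_FL) N ∏_{p<z} (1 − ω(p)/p) + z²`.
4. `∏_{p<z}(1 − ω(p)/p) = [∏_{p<z}(1 − 1/p)^{-k}(1 − ω(p)/p)] · (∏_{p<z}(1 − 1/p))^k`
   (`PolyPrimeCountBrun.prod_one_sub_rootCount_eq`); the first factor tends to `C`, which is
   POSITIVE by the tree's PROVED `exists_hasBatemanHornConst_holds` (`BatemanHornProofs.lean`,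
   Bateman–Horn 1962 §2 = Thm 5.4.3 of the source) and uniqueness of limits, so it is `≤ 2C`
   eventually; the second is `≤ (A₁/log z)^k` by Mertens
   (`Lichtman2020.prod_primesLE_one_sub_inv_le`, from `MertensBound.prod_one_sub_inv_prime_Icc_le`).
5. With `z = ⌊N^{1/4}⌋ + 1` all error terms are `O(N^{1/2}) ≤ C · N/(log N)^k` eventually (this is
   where `C > 0` is used), and `N/(log N)^k ≤ c_k ∫₂ᴺ dt/(log t)^k` eventually
   (`isEquivalent_offsetLogIntegralPow_holds`). The constant obtained is
   `B = ((1 + C_FL(2D, K_D)) · 2 · (8A₁)^k + 1) · c_k · ∏ dᵢ`, a function of `k` and `d` only.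

## Design notes

* The case `C = 0` of the fact (which would demand `Q(f; x) = 0` eventually) is vacuous only
  because the Bateman–Horn constant of a Bateman–Horn system is positive; this is why the
  discharge depends on `exists_hasBatemanHornConst_holds` (Dedekind zeta residue + Tauberian route
  of `DegreeOnePrimes.lean`), although the sieve bound itself is elementary.
* If some `dᵢ = 0` no Bateman–Horn system has these degrees
  (`IsBatemanHornSystem.natDegree_pos`, `BatemanHornProofs.lean`), so the (junk) value
  `B · C / 0 = 0` is never met.
* Helper lemmas live in the sub-namespace `PolyPrimeCountBrun` (they are specific to this proof).
  Reused rather than restated: the translation invariance `ω_{g(t+c)}(p) = ω_g(p)`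
  (`Literature.Barriers.Parity.polyRootCountMod_comp_X_add_C`) and the polynomial growth lemma
  `Literature.Barriers.Parity.exists_forall_le_eval_of_leadingCoeff_pos` (whence the import of
  `Literature/Barriers/Parity/UniformBatemanHornBunyakovsky.lean`), and the Mertens product bound
  `Lichtman2020.prod_primesLE_one_sub_inv_le` (`MoebiusShiftedPrimesSieveBound.lean`).

## References

* S. L. Aletheia-Zomlefer, L. Fukshansky, S. R. Garcia, Expo. Math. 38 (2020) 430–479,
  arXiv:1807.08899v4, §3.6 (p. 10). [AletheiaZomleferFukshanskyGarcia2020]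
* H. Halberstam, H.-E. Richert, *Sieve Methods* (1974), Thm 2.5 (Fundamental Lemma), Thm 5.3.
* G. Tenenbaum, *Introduction to analytic and probabilistic number theory*, §I.4.2, Thm 3.
-/

noncomputable section

open Filter Finset Polynomial Asymptotics
open scoped Topology

namespace Literature.NumberTheory.Sieve

namespace PolyPrimeCountBrun

/-- Lagrange from `ω < p`: if `g` has fewer than `p` roots modulo the prime `p` then `g mod p ≠ 0`,
so `g` has at most `deg g` roots modulo `p`. [folklore] -/
theorem polyRootCountMod_single_le_natDegree_of_lt {g : ℤ[X]} {p : ℕ} (hp : p.Prime)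
    (hlt : polyRootCountMod ![g] p < p) : polyRootCountMod ![g] p ≤ g.natDegree := by
  classical
  haveI := Fact.mk hp
  rw [polyRootCountMod_single] at hlt ⊢
  set g' : (ZMod p)[X] := g.map (Int.castRingHom (ZMod p)) with hg'
  have hev : ∀ n : ℕ, g'.eval (n : ZMod p) = ((g.eval (n : ℤ) : ℤ) : ZMod p) := fun n ↦ by
    rw [hg', ← Int.cast_natCast (R := ZMod p) n, eval_intCast_map, eq_intCast, Int.cast_id]
  have hg'0 : g' ≠ 0 := by
    intro h0
    refine hlt.ne ?_
    rw [Finset.filter_true_of_mem, card_range]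
    intro n _
    rw [← ZMod.intCast_zmod_eq_zero_iff_dvd, ← hev, h0, eval_zero]
  calc #((range p).filter fun n : ℕ ↦ (p : ℤ) ∣ g.eval (n : ℤ))
      ≤ #(g'.roots.toFinset) := by
        refine Finset.card_le_card_of_injOn (fun n : ℕ ↦ (n : ZMod p)) ?_ ?_
        · intro n hn
          rw [mem_coe, mem_filter, mem_range] at hn
          simp only [mem_coe, Multiset.mem_toFinset, mem_roots hg'0, IsRoot.def]
          rw [hev, ZMod.intCast_zmod_eq_zero_iff_dvd]
          exact hn.2
        · intro m hm n hn hmn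
          rw [mem_coe, mem_filter, mem_range] at hm hn
          have := congrArg ZMod.val hmn
          rwa [ZMod.val_natCast_of_lt hm.1, ZMod.val_natCast_of_lt hn.1] at this
    _ ≤ Multiset.card g'.roots := Multiset.toFinset_card_le _
    _ ≤ g'.natDegree := card_roots' _
    _ ≤ g.natDegree := natDegree_map_le

/-- `ω_f(p)` of a family is the root count of the product polynomial. [folklore] -/
theorem polyRootCountMod_eq_single_prod {k : ℕ} (f : Fin k → ℤ[X]) (p : ℕ) :
    polyRootCountMod f p = polyRootCountMod ![∏ i, f i] p := by
  rw [polyRootCountMod_single]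
  unfold polyRootCountMod
  simp_rw [eval_prod]

/-- **The root-count density of bounded root count has finite sieve dimension, uniformly.** If
`ω_F(p) ≤ D` and `ω_F(p) < p` for every prime `p`, then `0 ≤ ω_F(p)/p < 1` and, for
`2 ≤ w ≤ z`, `∏_{w ≤ p < z} (1 − ω_F(p)/p)⁻¹ ≤ K_D (log z/log w)^{2D}` with
`K_D = (2D+1)^{2D+1} e^{2D(9/2 + 6/log 2)}` (termwise `(1 − ω/p)⁻¹ ≤ p ≤ 2D + 1` for `p ≤ 2D` and
`(1 − ω/p)⁻¹ ≤ e^{2D/p}` for `p > 2D`, then Mertens over the window,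
`sum_primesWindow_one_div_le`). The constants depend on `D` only. [folklore] -/
theorem hasSieveDimension_rootDensity_of_le {F : ℤ[X]} {D : ℕ}
    (hle : ∀ p : ℕ, p.Prime → polyRootCountMod ![F] p ≤ D)
    (hlt : ∀ p : ℕ, p.Prime → polyRootCountMod ![F] p < p) :
    HasSieveDimension (rootDensity F) (2 * D)
      (((2 * D + 1 : ℕ) : ℝ) ^ (2 * D + 1) * Real.exp (2 * D * (9 / 2 + 6 / Real.log 2))) := by
  have hg : ∀ p : ℕ, p.Prime → 0 ≤ rootDensity F p ∧ rootDensity F p < 1 := by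
    intro p hp
    refine ⟨rootDensity_nonneg F p, ?_⟩
    rw [rootDensity_apply, div_lt_one (by exact_mod_cast hp.pos)]
    exact_mod_cast hlt p hp
  refine ⟨hg, fun w z hw hwz => ?_⟩
  set S := (Nat.primesBelow ⌈z⌉₊).filter (fun p : ℕ => w ≤ (p : ℝ)) with hS
  have hlogw : 0 < Real.log w := Real.log_pos (by linarith)
  have hlogz : 0 < Real.log z := Real.log_pos (by linarith)
  have hprime : ∀ p ∈ S, p.Prime := fun p hp =>
    (Nat.mem_primesBelow.mp (Finset.mem_filter.mp hp).1).2
  set M : ℝ := ((2 * D + 1 : ℕ) : ℝ) with hM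
  have hM1 : 1 ≤ M := by rw [hM]; exact_mod_cast Nat.succ_le_succ (Nat.zero_le _)
  set E : ℕ → ℝ := fun p => Real.exp (2 * D * (1 / (p : ℝ))) with hE
  -- termwise bound
  have hpt : ∀ p ∈ S, (1 - rootDensity F p)⁻¹ ≤ (if p ≤ 2 * D then M else 1) * E p := by
    intro p hp
    have hpp : p.Prime := hprime p hp
    have hp0 : (0 : ℝ) < p := by exact_mod_cast hpp.pos
    have hE1 : 1 ≤ E p := Real.one_le_exp (by positivity)
    have hρD : (polyRootCountMod ![F] p : ℝ) ≤ D := by exact_mod_cast hle p hpp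
    have hρp : (polyRootCountMod ![F] p : ℝ) + 1 ≤ p := by
      exact_mod_cast Nat.succ_le_of_lt (hlt p hpp)
    rw [rootDensity_apply]
    by_cases hpD : p ≤ 2 * D
    · rw [if_pos hpD]
      have h1 : 1 - (polyRootCountMod ![F] p : ℝ) / p =
          ((p : ℝ) - polyRootCountMod ![F] p) / p := by
        field_simp
      have hden : (1 : ℝ) ≤ (p : ℝ) - polyRootCountMod ![F] p := by linarith
      calc (1 - (polyRootCountMod ![F] p : ℝ) / p)⁻¹
          = p / ((p : ℝ) - polyRootCountMod ![F] p) := by rw [h1, inv_div]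
        _ ≤ p := div_le_self hp0.le hden
        _ ≤ M := by rw [hM]; exact_mod_cast (by omega : p ≤ 2 * D + 1)
        _ ≤ M * E p := le_mul_of_one_le_right (by linarith) hE1
    · rw [if_neg hpD, one_mul]
      push Not at hpD
      set t : ℝ := (polyRootCountMod ![F] p : ℝ) / p with ht
      have ht0 : 0 ≤ t := by positivity
      have h2D : (2 * D : ℝ) < p := by exact_mod_cast hpD
      have ht2 : t ≤ 1 / 2 := by
        rw [ht, div_le_iff₀ hp0]
        linarith
      have htD : t ≤ D * (1 / (p : ℝ)) := by
        rw [ht, mul_one_div]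
        exact div_le_div_of_nonneg_right hρD hp0.le
      -- `(1 - t)⁻¹ ≤ e^{2t}` for `0 ≤ t ≤ 1/2`, since `(1 + 2t)(1 - t) ≥ 1` there
      have hinv : (1 - t)⁻¹ ≤ Real.exp (2 * t) := by
        have h1t : 0 < 1 - t := by linarith
        rw [inv_eq_one_div, div_le_iff₀ h1t]
        have hA : (2 * t + 1) * (1 - t) ≤ Real.exp (2 * t) * (1 - t) :=
          mul_le_mul_of_nonneg_right (Real.add_one_le_exp _) h1t.le
        have hB : 1 ≤ (2 * t + 1) * (1 - t) := by nlinarith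
        linarith
      calc (1 - t)⁻¹ ≤ Real.exp (2 * t) := hinv
        _ ≤ E p := Real.exp_le_exp.mpr (by linarith)
  have hnonneg : ∀ p ∈ S, 0 ≤ (1 - rootDensity F p)⁻¹ := fun p hp =>
    inv_nonneg.mpr (sub_nonneg.mpr (hg p (hprime p hp)).2.le)
  have hsum1 : ∑ p ∈ S, (1 : ℝ) / p ≤
      Real.log (Real.log z) - Real.log (Real.log w) + (9 / 2 + 6 / Real.log 2) :=
    sum_primesWindow_one_div_le hw hwz
  have hprodM : ∏ p ∈ S, (if p ≤ 2 * D then M else 1) ≤ M ^ (2 * D + 1) := by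
    rw [Finset.prod_ite, Finset.prod_const_one, mul_one, Finset.prod_const]
    refine pow_le_pow_right₀ hM1 ?_
    calc #(S.filter fun p => p ≤ 2 * D) ≤ #(range (2 * D + 1)) :=
          card_le_card fun p hp => by
            rw [mem_filter] at hp
            rw [mem_range]
            omega
      _ = 2 * D + 1 := card_range _
  have hprodE : ∏ p ∈ S, E p = Real.exp (2 * D * ∑ p ∈ S, (1 : ℝ) / p) := by
    rw [Finset.mul_sum, Real.exp_sum]
  have hLL : Real.exp (Real.log (Real.log z) - Real.log (Real.log w)) = Real.log z / Real.log w := by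
    rw [Real.exp_sub, Real.exp_log hlogz, Real.exp_log hlogw]
  have hexp : Real.exp (2 * D * ∑ p ∈ S, (1 : ℝ) / p) ≤
      Real.exp (2 * D * (9 / 2 + 6 / Real.log 2)) * (Real.log z / Real.log w) ^ (2 * (D : ℝ)) := by
    have hD0 : (0 : ℝ) ≤ 2 * D := by positivity
    calc Real.exp (2 * D * ∑ p ∈ S, (1 : ℝ) / p)
        ≤ Real.exp (2 * D * (Real.log (Real.log z) - Real.log (Real.log w) +
            (9 / 2 + 6 / Real.log 2))) :=
          Real.exp_le_exp.mpr (mul_le_mul_of_nonneg_left hsum1 hD0)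
      _ = Real.exp (2 * D * (9 / 2 + 6 / Real.log 2)) *
            (Real.log z / Real.log w) ^ (2 * (D : ℝ)) := by
          have e1 : 2 * (D : ℝ) * (Real.log (Real.log z) - Real.log (Real.log w) +
              (9 / 2 + 6 / Real.log 2)) = 2 * D * (9 / 2 + 6 / Real.log 2) +
                ((2 * D : ℕ) : ℝ) * (Real.log (Real.log z) - Real.log (Real.log w)) := by
            push_cast; ring
          have e2 : (2 * (D : ℝ)) = ((2 * D : ℕ) : ℝ) := by push_cast; ring
          rw [e1, Real.exp_add, Real.exp_nat_mul, hLL, e2, Real.rpow_natCast]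
  calc ∏ p ∈ S, (1 - rootDensity F p)⁻¹
      ≤ ∏ p ∈ S, ((if p ≤ 2 * D then M else 1) * E p) := Finset.prod_le_prod hnonneg hpt
    _ = (∏ p ∈ S, (if p ≤ 2 * D then M else 1)) * ∏ p ∈ S, E p := Finset.prod_mul_distrib
    _ ≤ M ^ (2 * D + 1) * ∏ p ∈ S, E p :=
        mul_le_mul_of_nonneg_right hprodM (Finset.prod_nonneg fun p _ => (Real.exp_pos _).le)
    _ ≤ M ^ (2 * D + 1) * (Real.exp (2 * D * (9 / 2 + 6 / Real.log 2)) *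
          (Real.log z / Real.log w) ^ (2 * (D : ℝ))) := by
        rw [hprodE]
        exact mul_le_mul_of_nonneg_left hexp (by positivity)
    _ = M ^ (2 * D + 1) * Real.exp (2 * D * (9 / 2 + 6 / Real.log 2)) *
          (Real.log z / Real.log w) ^ (2 * (D : ℝ)) := by ring

/-- `∏_{p ≤ y} (1 − ω_f(p)/p) = [∏_{p ≤ y} (1 − 1/p)^{-k}(1 − ω_f(p)/p)] · (∏_{p ≤ y} (1 − 1/p))^k`:
the sieve product is the Bateman–Horn partial product times the `k`-th power of the Mertens
product. [folklore] -/
theorem prod_one_sub_rootCount_eq {k : ℕ} (f : Fin k → ℤ[X]) (y : ℕ) :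
    ∏ p ∈ Nat.primesLE y, (1 - (polyRootCountMod f p : ℝ) / p) =
      batemanHornPartial f y * (∏ p ∈ Nat.primesLE y, (1 - 1 / (p : ℝ))) ^ k := by
  unfold batemanHornPartial
  rw [Fintype.card_fin, ← prod_pow, ← prod_mul_distrib]
  refine prod_congr rfl fun p hp => ?_
  have hp2 : (2 : ℝ) ≤ p := by exact_mod_cast (Nat.prime_of_mem_primesLE hp).two_le
  have hne : (1 : ℝ) - 1 / p ≠ 0 := by
    have : (1 : ℝ) / p ≤ 1 / 2 := one_div_le_one_div_of_le (by norm_num) hp2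
    linarith
  rw [mul_right_comm, ← mul_pow, inv_mul_cancel₀ hne, one_pow, one_mul]

/-- **Reduction of `Q(f; N)` to a sifted set.** Let `n₀` be such that `fᵢ(n) ≥ 1` for all
`n ≥ n₀` and all `i`, and put `F(t) = ∏ᵢ fᵢ(t + n₀)`. If every `fᵢ(n)` (`n ≤ N`) is prime then
either `n ≤ n₀`, or `n = m + n₀` with `1 ≤ m ≤ N` and either `F(m)` has no prime factor `< z`
or some `fᵢ(m + n₀)` is a prime `< z`; a non-constant `fᵢ` takes each value at most `deg fᵢ`
times. Hence `Q(f; N) ≤ (n₀ + 1) + #{1 ≤ m ≤ N : (F(m), P(z)) = 1} + (∑ deg fᵢ)(z + 1)`.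
[folklore] -/
theorem polyPrimeCount_le_card_coprime_add {k : ℕ} (f : Fin k → ℤ[X]) (n₀ : ℕ)
    (hpos : ∀ i, ∀ n : ℕ, n₀ ≤ n → 1 ≤ (f i).eval (n : ℤ))
    (hdeg : ∀ i, 0 < (f i).natDegree) (N : ℕ) {z : ℝ} (hz : 0 ≤ z) :
    (polyPrimeCount f N : ℝ) ≤ (n₀ + 1 : ℕ) +
      #((Ioc 0 N).filter fun m : ℕ =>
        (((∏ i, f i).comp (X + C (n₀ : ℤ))).eval (m : ℤ)).natAbs.Coprime (primesProdBelow z)) +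
      (∑ i, ((f i).natDegree : ℝ)) * (z + 1) := by
  classical
  set F := (∏ i, f i).comp (X + C (n₀ : ℤ)) with hF
  have hFeval : ∀ m : ℕ, F.eval (m : ℤ) = ∏ i, (f i).eval ((m : ℤ) + n₀) := fun m => by
    simp [hF, eval_comp, eval_prod]
  set T := (Ioc 0 N).filter fun m : ℕ => ∀ i, ((f i).eval ((m : ℤ) + n₀)).toNat.Prime with hT
  set T₁ := (Ioc 0 N).filter fun m : ℕ =>
    (F.eval (m : ℤ)).natAbs.Coprime (primesProdBelow z) with hT₁
  let Tb : Fin k → Finset ℕ := fun i =>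
    (Ioc 0 N).filter fun m : ℕ => ((f i).eval ((m : ℤ) + n₀)).toNat < ⌈z⌉₊
  have hTb : ∀ i m, m ∈ Tb i ↔ m ∈ Ioc 0 N ∧ ((f i).eval ((m : ℤ) + n₀)).toNat < ⌈z⌉₊ :=
    fun i m => by simp [Tb]
  -- step 1: split off `n ≤ n₀` and translate
  have h1 : polyPrimeCount f N ≤ (n₀ + 1) + #T := by
    unfold polyPrimeCount
    refine (card_le_card (t := range (n₀ + 1) ∪ T.image (· + n₀)) ?_).trans
      ((card_union_le _ _).trans ?_)
    swap
    · rw [card_range]; exact Nat.add_le_add_left card_image_le _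
    intro n hn
    simp only [mem_filter, mem_range] at hn
    obtain ⟨hnN, hPn⟩ := hn
    rw [mem_union, mem_range, mem_image]
    by_cases hnn : n < n₀ + 1
    · exact Or.inl hnn
    · right
      refine ⟨n - n₀, ?_, by omega⟩
      rw [hT, mem_filter, mem_Ioc]
      refine ⟨⟨by omega, by omega⟩, fun i => ?_⟩
      have : ((n - n₀ : ℕ) : ℤ) + n₀ = n := by
        rw [Nat.cast_sub (by omega)]
        ring
      rw [this]
      exact (hPn i).2
  -- step 2: `T ⊆ T₁ ∪ ⋃ᵢ Tb i`
  have h2 : #T ≤ #T₁ + ∑ i, #(Tb i) := by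
    calc #T ≤ #(T₁ ∪ Finset.univ.biUnion Tb) := card_le_card ?_
      _ ≤ #T₁ + #(Finset.univ.biUnion Tb) := card_union_le _ _
      _ ≤ #T₁ + ∑ i, #(Tb i) := Nat.add_le_add_left card_biUnion_le _
    intro m hm
    rw [hT, mem_filter] at hm
    obtain ⟨hmI, hprime⟩ := hm
    rw [mem_union]
    by_cases hsmall : ∃ i, ((f i).eval ((m : ℤ) + n₀)).toNat < ⌈z⌉₊
    · right
      obtain ⟨i, hi⟩ := hsmall
      rw [mem_biUnion]
      exact ⟨i, mem_univ _, (hTb i m).mpr ⟨hmI, hi⟩⟩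
    · left
      push Not at hsmall
      rw [hT₁, mem_filter]
      refine ⟨hmI, ?_⟩
      rw [coprime_primesProdBelow_iff]
      intro q hq hqd
      rw [Nat.mem_primesBelow] at hq
      have hfac : ∀ i, (f i).eval ((m : ℤ) + n₀) =
          ((((f i).eval ((m : ℤ) + n₀)).toNat : ℕ) : ℤ) := fun i => by
        rw [Int.toNat_of_nonneg]
        have := hpos i (m + n₀) (Nat.le_add_left _ _)
        push_cast at this
        linarith
      have hnat : (F.eval (m : ℤ)).natAbs = ∏ i, ((f i).eval ((m : ℤ) + n₀)).toNat := by
        have hF0 : 0 ≤ F.eval (m : ℤ) := by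
          rw [hFeval]
          exact prod_nonneg fun i _ => by rw [hfac i]; positivity
        apply Nat.cast_injective (R := ℤ)
        rw [Int.natCast_natAbs, abs_of_nonneg hF0, hFeval, Nat.cast_prod]
        exact prod_congr rfl fun i _ => hfac i
      rw [hnat] at hqd
      obtain ⟨i, -, hi⟩ := (Prime.dvd_finsetProd_iff hq.2.prime _).mp hqd
      have heq := (Nat.prime_dvd_prime_iff_eq hq.2 (hprime i)).mp hi
      have := hsmall i
      omega
  -- step 3: each `fᵢ(· + n₀)` takes each value `< z` at most `deg fᵢ` times
  have h3 : ∀ i, #(Tb i) ≤ (f i).natDegree * ⌈z⌉₊ := by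
    intro i
    let v : ℕ → ℕ := fun m => ((f i).eval ((m : ℤ) + n₀)).toNat
    have hmaps : ∀ m ∈ Tb i, v m ∈ range ⌈z⌉₊ := fun m hm =>
      mem_range.mpr ((hTb i m).mp hm).2
    have hfib : ∀ a ∈ range ⌈z⌉₊, #((Tb i).filter fun m => v m = a) ≤ (f i).natDegree := by
      intro a _
      set g : ℤ[X] := f i - C (a : ℤ) with hg
      have hgdeg : g.natDegree = (f i).natDegree := by rw [hg, natDegree_sub_C]
      have hg0 : g ≠ 0 := by
        intro h0
        have : (f i).natDegree = 0 := by rw [← hgdeg, h0, natDegree_zero]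
        exact (hdeg i).ne' this
      calc #((Tb i).filter fun m => v m = a) ≤ #(g.roots.toFinset) := by
            refine card_le_card_of_injOn (fun m : ℕ => (m : ℤ) + n₀) ?_ ?_
            · intro m hm
              rw [mem_coe, mem_filter] at hm
              obtain ⟨hmT, hma⟩ := hm
              rw [mem_coe, Multiset.mem_toFinset, mem_roots hg0, IsRoot.def, hg, eval_sub, eval_C,
                sub_eq_zero]
              have h1 := hpos i (m + n₀) (Nat.le_add_left _ _)
              push_cast at h1
              rw [← hma]
              exact (Int.toNat_of_nonneg (by linarith)).symm
            · intro m₁ _ m₂ _ h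
              have : (m₁ : ℤ) = m₂ := add_right_cancel h
              exact_mod_cast this
        _ ≤ Multiset.card g.roots := Multiset.toFinset_card_le _
        _ ≤ g.natDegree := card_roots' _
        _ = (f i).natDegree := hgdeg
    calc #(Tb i) ≤ (f i).natDegree * #(range ⌈z⌉₊) :=
          card_le_mul_card_image_of_maps_to hmaps _ hfib
      _ = (f i).natDegree * ⌈z⌉₊ := by rw [card_range]
  -- assemble
  have hceil : (⌈z⌉₊ : ℝ) ≤ z + 1 := (Nat.ceil_lt_add_one hz).le
  have h3' : (∑ i, (#(Tb i) : ℝ)) ≤ (∑ i, ((f i).natDegree : ℝ)) * (z + 1) := by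
    rw [sum_mul]
    refine sum_le_sum fun i _ => ?_
    calc (#(Tb i) : ℝ) ≤ (((f i).natDegree * ⌈z⌉₊ : ℕ) : ℝ) := by exact_mod_cast h3 i
      _ = (f i).natDegree * (⌈z⌉₊ : ℝ) := by push_cast; ring
      _ ≤ (f i).natDegree * (z + 1) := mul_le_mul_of_nonneg_left hceil (Nat.cast_nonneg _)
  have h12 : polyPrimeCount f N ≤ (n₀ + 1) + #T₁ + ∑ i, #(Tb i) := by omega
  calc (polyPrimeCount f N : ℝ) ≤ (((n₀ + 1) + #T₁ + ∑ i, #(Tb i) : ℕ) : ℝ) := by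
        exact_mod_cast h12
    _ = (n₀ + 1 : ℕ) + #T₁ + ∑ i, (#(Tb i) : ℝ) := by push_cast; ring
    _ ≤ (n₀ + 1 : ℕ) + #T₁ + (∑ i, ((f i).natDegree : ℝ)) * (z + 1) := by linarith

/-- **The upper-bound sieve for the values `F(m)`, `1 ≤ m ≤ N`** (Fundamental Lemma with level
`D = z`, `s = 1`): if `F(m) > 0` for `m ≥ 1`, the density `ω_F(m)/m` has dimension `κ` with
constant `K`, and `C` is the constant of the (uniform) Fundamental Lemma for `(κ, K)`, then
`#{1 ≤ m ≤ N : (F(m), P(z)) = 1} ≤ (1 + C) N ∏_{p<z} (1 − ω_F(p)/p) + z²` for `z ≥ 2` (the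
remainder sum is `≤ ∑_{m ∣ P(z), m ≤ z} ω_F(m) ≤ z²`). [folklore] -/
theorem card_coprime_le_of_fundamentalLemma {κ K CFL : ℝ} (hCFL : 0 ≤ CFL)
    (hFL : ∀ A : SieveSequence, HasSieveDimension A.density κ K →
      ∀ x z D : ℝ, 2 ≤ z → z ≤ D → 0 ≤ A.size x →
        |A.sifted x (primesProdBelow z) - A.size x * A.densityProduct (primesProdBelow z)| ≤
          CFL * A.size x * A.densityProduct (primesProdBelow z) *
              Real.exp (-(Real.log D / Real.log z)) +
            ∑ d ∈ (primesProdBelow z).divisors.filter (fun d : ℕ => (d : ℝ) ≤ D),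
              |A.remainder d x|)
    {F : ℤ[X]} (hdim : HasSieveDimension (rootDensity F) κ K)
    (hFpos : ∀ m : ℕ, 0 < m → 0 < F.eval (m : ℤ)) (N : ℕ) {z : ℝ} (hz : 2 ≤ z) :
    (#((Ioc 0 N).filter fun m : ℕ =>
        (F.eval (m : ℤ)).natAbs.Coprime (primesProdBelow z)) : ℝ) ≤
      (1 + CFL) * N * (∏ p ∈ Nat.primesBelow ⌈z⌉₊, (1 - (polyRootCountMod ![F] p : ℝ) / p)) +
        z ^ 2 := by
  set A := polyAPSeq F N 1 0 with hA
  set x : ℝ := ∑ m ∈ Ioc 0 N, ((F.eval (m : ℤ) : ℤ) : ℝ) with hx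
  have hxb : ∀ m ∈ apIndex N 1 0, 0 < F.eval (m : ℤ) ∧ ((F.eval (m : ℤ) : ℤ) : ℝ) ≤ x := by
    intro m hm
    rw [apIndex_one, mem_Ioc] at hm
    refine ⟨hFpos m hm.1, ?_⟩
    rw [hx]
    exact single_le_sum (f := fun m : ℕ => ((F.eval (m : ℤ) : ℤ) : ℝ)) (fun n hn => by
      rw [mem_Ioc] at hn
      exact_mod_cast (hFpos n hn.1).le) (mem_Ioc.mpr hm)
  have hdimA : HasSieveDimension A.density κ K := hdim
  have hX : 0 ≤ A.size x := by rw [hA, polyAPSeq_size]; positivity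
  have h := hFL A hdimA x z z hz le_rfl hX
  rw [hA, polyAPSeq_sifted F N 1 0 hxb, polyAPSeq_size, polyAPSeq_densityProduct, apIndex_one,
    Nat.cast_one, div_one] at h
  have hR := sum_abs_remainder_polyAPSeq_le F (N := N) (r := 0) Nat.one_pos (z := z) (D := z)
    (fun p hp _ => hp.not_dvd_one) hxb
  have hz0 : 0 ≤ z := by linarith
  have hR2 : ∑ m ∈ (primesProdBelow z).divisors.filter (fun m : ℕ => (m : ℝ) ≤ z),
      (polyRootCountMod ![F] m : ℝ) ≤ z ^ 2 := by
    set W := (primesProdBelow z).divisors.filter (fun m : ℕ => (m : ℝ) ≤ z) with hW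
    calc ∑ m ∈ W, (polyRootCountMod ![F] m : ℝ) ≤ ∑ m ∈ W, z := sum_le_sum fun m hm => by
          have h2 := (mem_filter.mp hm).2
          exact le_trans (by exact_mod_cast polyRootCountMod_le ![F] m) h2
      _ = #W * z := by rw [sum_const, nsmul_eq_mul]
      _ ≤ z * z := by
          refine mul_le_mul_of_nonneg_right ?_ hz0
          calc (#W : ℝ) ≤ #(Icc 1 ⌊z⌋₊) := by
                exact_mod_cast card_le_card (fun m hm => by
                  rw [hW, mem_filter, Nat.mem_divisors] at hm
                  rw [mem_Icc]
                  exact ⟨Nat.pos_of_dvd_of_pos hm.1.1 (Nat.pos_of_ne_zero hm.1.2),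
                    Nat.le_floor hm.2⟩)
            _ = ⌊z⌋₊ := by simp
            _ ≤ z := Nat.floor_le hz0
      _ = z ^ 2 := (sq z).symm
  have hexp : Real.exp (-(Real.log z / Real.log z)) ≤ 1 := by
    rw [Real.exp_le_one_iff, neg_nonpos]
    exact div_nonneg (Real.log_nonneg (by linarith)) (Real.log_nonneg (by linarith))
  set V := ∏ p ∈ Nat.primesBelow ⌈z⌉₊, (1 - (polyRootCountMod ![F] p : ℝ) / p) with hV
  have hV0 : 0 ≤ V := prod_nonneg fun p _ => by
    have := rootDensity_le_one F p
    rw [rootDensity_apply] at this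
    linarith
  have hmain : CFL * N * V * Real.exp (-(Real.log z / Real.log z)) ≤ CFL * N * V :=
    mul_le_of_le_one_right (by positivity) hexp
  have hab := (abs_le.mp h).2
  linarith [hR.trans hR2]


end PolyPrimeCountBrun

open PolyPrimeCountBrun in
/-- **§3.6 of the source, discharged: the Brun-sieve upper bound for Bateman–Horn systems.**
For every `k` and degrees `d₁, …, d_k` there is `B = B(k, d)` such that for every Bateman–Horn
system `f` with `deg fᵢ = dᵢ` and Bateman–Horn constant `C`,
`Q(f; x) ≤ B · C/(∏ dᵢ) · ∫₂ˣ dt/(log t)^k` for all large `x`.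

Proof (the standard upper-bound sieve, here through the tree's Fundamental Lemma
`SieveSequence.fundamental_lemma_uniform_holds` rather than Brun's pure sieve): translate so that
all `fᵢ(m + n₀) ≥ 1` for `m ≥ 1` and sift the values `F(m) = ∏ fᵢ(m + n₀)`, `1 ≤ m ≤ N`, by the
primes `< z = ⌊N^{1/4}⌋ + 1` (`polyPrimeCount_le_card_coprime_add`: the `n` with all `fᵢ(n)`
prime are covered up to `(n₀ + 1) + (∑ dᵢ)(z + 1)` exceptions). The density `ω_F(m)/m` is
multiplicative with `ω_F(p) = ω_f(p) ≤ ∑ dᵢ`, `ω_F(p) < p`, so it has sieve dimension `2∑dᵢ` with a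
constant depending on the degrees only (`hasSieveDimension_rootDensity_of_le`), and the
Fundamental Lemma with level `z` gives `≤ (1 + C_FL) N ∏_{p<z}(1 − ω(p)/p) + z²`
(`card_coprime_le_of_fundamentalLemma`). Finally
`∏_{p<z}(1 − ω(p)/p) = [Bateman–Horn partial product] · (∏_{p<z}(1 − 1/p))^k ≤ 2C (8A/log N)^k`
by the convergence of the partial products to `C > 0` (the tree's PROVED
`exists_hasBatemanHornConst_holds`, uniqueness of limits) and Mertens
(`prod_primesLE_one_sub_one_div_le`), the `O(N^{1/2})` terms are absorbed since `C > 0`, and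
`N/(log N)^k ≍ ∫₂ᴺ dt/(log t)^k` (`isEquivalent_offsetLogIntegralPow_holds`). The source cites
Tenenbaum, *Introduction to analytic and probabilistic number theory*, Thm. 3 of §I.4.2.
[cite: AletheiaZomleferFukshanskyGarcia2020, §3.6 (display after (3.6.3), Brun sieve)] -/
theorem polyPrimeCount_le_brunSieve_holds : polyPrimeCount_le_brunSieve := by
  intro k d
  -- constants depending on `k` and `d` only
  set D : ℕ := ∑ i, d i with hD
  set κ : ℝ := 2 * (D : ℝ) with hκ
  set K : ℝ := ((2 * D + 1 : ℕ) : ℝ) ^ (2 * D + 1) * Real.exp (2 * D * (9 / 2 + 6 / Real.log 2))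
    with hK
  obtain ⟨CFL, hCFL0, hFL⟩ := SieveSequence.fundamental_lemma_uniform_holds κ K
  set A₁ : ℝ := Real.exp (6 / Real.log 2) * Real.log 2 with hA₁
  have hA₁0 : 0 < A₁ := by rw [hA₁]; exact mul_pos (Real.exp_pos _) (Real.log_pos one_lt_two)
  obtain ⟨cLi, hcLi0, hcLi⟩ : ∃ c : ℝ, 0 < c ∧ ∀ᶠ x : ℝ in atTop,
      x / Real.log x ^ k ≤ c * LFunctions.offsetLogIntegralPow k x := by
    obtain ⟨c, hc0, hc⟩ :=
      ((LFunctions.isEquivalent_offsetLogIntegralPow_holds k).symm).isBigO.exists_pos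
    refine ⟨c, hc0, ?_⟩
    filter_upwards [hc.bound, eventually_ge_atTop (2 : ℝ)] with x hx hx2
    have h0 : 0 ≤ LFunctions.offsetLogIntegralPow k x :=
      LFunctions.offsetLogIntegralPow_nonneg k hx2
    calc x / Real.log x ^ k ≤ ‖x / Real.log x ^ k‖ := le_abs_self _
      _ ≤ c * ‖LFunctions.offsetLogIntegralPow k x‖ := hx
      _ = c * LFunctions.offsetLogIntegralPow k x := by rw [Real.norm_of_nonneg h0]
  set B₀ : ℝ := (1 + CFL) * 2 * (8 * A₁) ^ k + 1 with hB₀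
  have hB₀0 : 0 < B₀ := by positivity
  refine ⟨B₀ * cLi * ∏ i, (d i : ℝ), ?_⟩
  intro f hf hdeg C hC
  -- `C > 0` (convergence of the product to a positive limit, uniqueness of limits)
  obtain ⟨C₀, hC₀pos, hC₀⟩ := exists_hasBatemanHornConst_holds (ι := Fin k) hf
  have hCeq : C = C₀ := tendsto_nhds_unique hC hC₀
  have hCpos : 0 < C := hCeq ▸ hC₀pos
  -- degrees
  have hdpos' : ∀ i, 0 < (f i).natDegree := hf.natDegree_pos
  have hdpos : ∀ i, 0 < d i := fun i => hdeg i ▸ hdpos' i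
  have hprod_ne : (∏ i, (d i : ℝ)) ≠ 0 :=
    prod_ne_zero_iff.mpr fun i _ => by exact_mod_cast (hdpos i).ne'
  have hsumdeg : (∑ i, ((f i).natDegree : ℝ)) = D := by
    rw [hD]; push_cast; exact sum_congr rfl fun i _ => by rw [hdeg i]
  -- `n₀`: all `fᵢ(n) ≥ 1` for `n ≥ n₀`
  have hn₀i : ∀ i, ∃ N₀ : ℕ, ∀ n : ℕ, N₀ ≤ n → 1 ≤ (f i).eval (n : ℤ) := by
    intro i
    obtain ⟨N₀, hN₀⟩ := Literature.Barriers.Parity.exists_forall_le_eval_of_leadingCoeff_pos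
      (hdpos' i) (hf.leadingCoeff_pos i) 1
    exact ⟨N₀, fun n hn => by exact_mod_cast hN₀ n hn⟩
  choose N₀ hN₀ using hn₀i
  set n₀ : ℕ := Finset.univ.sup N₀ with hn₀_def
  have hn₀ : ∀ i, ∀ n : ℕ, n₀ ≤ n → 1 ≤ (f i).eval (n : ℤ) := fun i n hn =>
    hN₀ i n ((Finset.le_sup (f := N₀) (mem_univ i)).trans hn)
  -- the shifted product polynomial
  set G : ℤ[X] := ∏ i, f i with hG
  set F : ℤ[X] := G.comp (X + Polynomial.C (n₀ : ℤ)) with hF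
  have hFeval : ∀ m : ℕ, F.eval (m : ℤ) = ∏ i, (f i).eval ((m : ℤ) + n₀) := fun m => by
    simp [hF, hG, eval_comp, eval_prod]
  have hρF : ∀ p, polyRootCountMod ![F] p = polyRootCountMod f p := fun p => by
    rw [hF, Literature.Barriers.Parity.polyRootCountMod_comp_X_add_C, hG,
      ← polyRootCountMod_eq_single_prod]
  have hρlt : ∀ p, p.Prime → polyRootCountMod ![F] p < p := fun p hp => by
    rw [hρF]; exact hf.hasNoFixedPrimeDivisor p hp
  have hρle : ∀ p, p.Prime → polyRootCountMod ![F] p ≤ D := fun p hp => by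
    rw [hρF p, polyRootCountMod_eq_single_prod]
    refine (polyRootCountMod_single_le_natDegree_of_lt hp ?_).trans ?_
    · rw [← polyRootCountMod_eq_single_prod]; exact hf.hasNoFixedPrimeDivisor p hp
    · refine (natDegree_prod_le _ _).trans (le_of_eq ?_)
      rw [hD]
      exact sum_congr rfl fun i _ => hdeg i
  have hdim : HasSieveDimension (rootDensity F) κ K := hasSieveDimension_rootDensity_of_le hρle hρlt
  have hFpos : ∀ m : ℕ, 0 < m → 0 < F.eval (m : ℤ) := fun m _ => by
    rw [hFeval]
    exact prod_pos fun i _ => by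
      have := hn₀ i (m + n₀) (Nat.le_add_left _ _)
      push_cast at this
      linarith
  -- eventualities in `N`
  have E1 : ∀ᶠ N : ℕ in atTop, batemanHornPartial f ⌊(N : ℝ) ^ (1 / 4 : ℝ)⌋₊ ≤ 2 * C := by
    have hy : Tendsto (fun N : ℕ => ⌊(N : ℝ) ^ (1 / 4 : ℝ)⌋₊) atTop atTop :=
      tendsto_nat_floor_atTop.comp
        ((tendsto_rpow_atTop (by norm_num)).comp tendsto_natCast_atTop_atTop)
    have h2C : ∀ᶠ y : ℕ in atTop, batemanHornPartial f y < 2 * C :=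
      hC.eventually (gt_mem_nhds (by linarith))
    exact (hy.eventually h2C).mono fun N h => h.le
  set Kf : ℝ := ((n₀ + 1 : ℕ) : ℝ) + 4 + 3 * D with hKf
  have hKf0 : 0 < Kf := by positivity
  have E3 : ∀ᶠ N : ℕ in atTop, Kf * (N : ℝ) ^ (1 / 2 : ℝ) ≤ C * ((N : ℝ) / Real.log N ^ k) := by
    have hlo := isLittleO_log_rpow_rpow_atTop (k : ℝ) (by norm_num : (0 : ℝ) < 1 / 2)
    have hev := hlo.def (div_pos hCpos hKf0)
    have hreal : ∀ᶠ x : ℝ in atTop, Kf * x ^ (1 / 2 : ℝ) ≤ C * (x / Real.log x ^ k) := by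
      filter_upwards [hev, eventually_gt_atTop (1 : ℝ)] with x hx hx1
      have hx0 : 0 < x := by linarith
      have hlog : 0 < Real.log x := Real.log_pos hx1
      rw [Real.norm_of_nonneg (Real.rpow_nonneg hlog.le _),
        Real.norm_of_nonneg (Real.rpow_nonneg hx0.le _), Real.rpow_natCast] at hx
      have hsq : x ^ (1 / 2 : ℝ) * x ^ (1 / 2 : ℝ) = x := by
        rw [← Real.rpow_add hx0]; norm_num
      rw [mul_div_assoc', le_div_iff₀ (pow_pos hlog k)]
      have h1 : Kf * Real.log x ^ k ≤ C * x ^ (1 / 2 : ℝ) := by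
        have := mul_le_mul_of_nonneg_left hx hKf0.le
        have e : Kf * (C / Kf * x ^ (1 / 2 : ℝ)) = C * x ^ (1 / 2 : ℝ) := by
          field_simp
        linarith
      calc Kf * x ^ (1 / 2 : ℝ) * Real.log x ^ k = x ^ (1 / 2 : ℝ) * (Kf * Real.log x ^ k) := by
            ring
        _ ≤ x ^ (1 / 2 : ℝ) * (C * x ^ (1 / 2 : ℝ)) :=
            mul_le_mul_of_nonneg_left h1 (Real.rpow_nonneg hx0.le _)
        _ = C * x := by rw [← mul_assoc, mul_comm _ C, mul_assoc, hsq]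
    exact tendsto_natCast_atTop_atTop.eventually hreal
  have E4 : ∀ᶠ N : ℕ in atTop,
      (N : ℝ) / Real.log N ^ k ≤ cLi * LFunctions.offsetLogIntegralPow k N :=
    tendsto_natCast_atTop_atTop.eventually hcLi
  filter_upwards [E1, eventually_ge_atTop (256 : ℕ), E3, E4] with N h1 hN h3 h4
  -- parameters at height `N`
  set a : ℝ := (N : ℝ) ^ (1 / 4 : ℝ) with ha
  set y : ℕ := ⌊a⌋₊ with hy
  set z : ℝ := ((y + 1 : ℕ) : ℝ) with hz
  have hN0 : (0 : ℝ) < N := by exact_mod_cast (show 0 < N by omega)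
  have hN256 : (256 : ℝ) ≤ N := by exact_mod_cast hN
  have h256 : (256 : ℝ) ^ (1 / 4 : ℝ) = 4 := by
    rw [show (256 : ℝ) = (4 : ℝ) ^ (4 : ℕ) by norm_num, ← Real.rpow_natCast,
      ← Real.rpow_mul (by norm_num : (0 : ℝ) ≤ 4)]
    norm_num
  have ha4 : (4 : ℝ) ≤ a := by
    calc (4 : ℝ) = (256 : ℝ) ^ (1 / 4 : ℝ) := h256.symm
      _ ≤ (N : ℝ) ^ (1 / 4 : ℝ) := Real.rpow_le_rpow (by norm_num) hN256 (by norm_num)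
  have ha1 : (1 : ℝ) ≤ a := by linarith
  have hy4 : 4 ≤ y := Nat.le_floor (by exact_mod_cast ha4)
  have hy2 : 2 ≤ y := by omega
  have hya : (y : ℝ) ≤ a := Nat.floor_le (by linarith)
  have hay : a / 2 ≤ y := by
    have := Nat.lt_floor_add_one a
    rw [← hy] at this
    linarith
  have hz2 : (2 : ℝ) ≤ z := by rw [hz]; exact_mod_cast (by omega : 2 ≤ y + 1)
  have hza : z ≤ a + 1 := by rw [hz]; push_cast; linarith
  have hz0 : (0 : ℝ) ≤ z := by linarith
  -- logarithms
  have hlogN : Real.log 256 ≤ Real.log N := Real.log_le_log (by norm_num) hN256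
  have hlog256 : Real.log 256 = 8 * Real.log 2 := by
    rw [show (256 : ℝ) = 2 ^ 8 by norm_num, Real.log_pow]; norm_num
  have hlog2pos : 0 < Real.log 2 := Real.log_pos one_lt_two
  have hlogNpos : 0 < Real.log N := by linarith
  have hloga : Real.log a = 1 / 4 * Real.log N := by rw [ha, Real.log_rpow hN0]
  have hlogy : Real.log N / 8 ≤ Real.log y := by
    calc Real.log N / 8 ≤ Real.log (a / 2) := by
          rw [Real.log_div (by linarith) (by norm_num), hloga]
          linarith
      _ ≤ Real.log y := Real.log_le_log (by linarith) hay
  have hlogypos : 0 < Real.log y := lt_of_lt_of_le (by positivity) hlogy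
  -- Mertens
  set M : ℝ := ∏ p ∈ Nat.primesLE y, (1 - 1 / (p : ℝ)) with hM
  have hM0 : 0 ≤ M := prod_nonneg fun p hp => by
    have : (2 : ℝ) ≤ p := by exact_mod_cast (Nat.prime_of_mem_primesLE hp).two_le
    have : (1 : ℝ) / p ≤ 1 / 2 := one_div_le_one_div_of_le (by norm_num) this
    linarith
  have hMle : M ≤ 8 * A₁ / Real.log N := by
    calc M ≤ Real.exp (6 / Real.log 2) * (Real.log 2 / Real.log y) :=
          Lichtman2020.prod_primesLE_one_sub_inv_le hy2
      _ = A₁ / Real.log y := by rw [hA₁]; ring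
      _ ≤ A₁ / (Real.log N / 8) := div_le_div_of_nonneg_left hA₁0.le (by positivity) hlogy
      _ = 8 * A₁ / Real.log N := by field_simp
  -- the sieve product `V(z)`
  have hVeq : ∏ p ∈ Nat.primesBelow ⌈z⌉₊, (1 - (polyRootCountMod ![F] p : ℝ) / p) =
      batemanHornPartial f y * M ^ k := by
    rw [hz, Nat.ceil_natCast]
    change ∏ p ∈ Nat.primesLE y, (1 - (polyRootCountMod ![F] p : ℝ) / p) = _
    simp_rw [hρF]
    exact prod_one_sub_rootCount_eq f y
  have hV : ∏ p ∈ Nat.primesBelow ⌈z⌉₊, (1 - (polyRootCountMod ![F] p : ℝ) / p) ≤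
      2 * C * ((8 * A₁) ^ k / Real.log N ^ k) := by
    rw [hVeq]
    have hMk : M ^ k ≤ (8 * A₁ / Real.log N) ^ k := pow_le_pow_left₀ hM0 hMle k
    rw [div_pow] at hMk
    exact mul_le_mul h1 hMk (pow_nonneg hM0 k) (by positivity)
  -- sieve and reduction
  have hS := card_coprime_le_of_fundamentalLemma hCFL0.le hFL hdim hFpos N hz2
  have hQ := polyPrimeCount_le_card_coprime_add f n₀ hn₀ hdpos' N hz0
  rw [hsumdeg] at hQ
  -- lower-order terms
  have hlow : ((n₀ + 1 : ℕ) : ℝ) + z ^ 2 + (D : ℝ) * (z + 1) ≤ Kf * (N : ℝ) ^ (1 / 2 : ℝ) := by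
    have hsq : a ^ 2 = (N : ℝ) ^ (1 / 2 : ℝ) := by
      rw [ha, ← Real.rpow_natCast, ← Real.rpow_mul hN0.le]; norm_num
    have ha2 : a ≤ a ^ 2 := by
      calc a = a * 1 := (mul_one a).symm
        _ ≤ a * a := mul_le_mul_of_nonneg_left ha1 (by linarith)
        _ = a ^ 2 := (sq a).symm
    have hD0 : (0 : ℝ) ≤ D := by positivity
    have hn1 : (0 : ℝ) ≤ ((n₀ + 1 : ℕ) : ℝ) := by positivity
    have h1' : ((n₀ + 1 : ℕ) : ℝ) ≤ ((n₀ + 1 : ℕ) : ℝ) * a ^ 2 :=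
      le_mul_of_one_le_right hn1 (one_le_pow₀ ha1)
    have h2' : z ^ 2 ≤ 4 * a ^ 2 := by
      have hz2a : z ≤ 2 * a := by linarith
      calc z ^ 2 ≤ (2 * a) ^ 2 := pow_le_pow_left₀ hz0 hz2a 2
        _ = 4 * a ^ 2 := by ring
    have h3' : (D : ℝ) * (z + 1) ≤ 3 * D * a ^ 2 := by
      have hz3 : z + 1 ≤ 3 * a ^ 2 := by linarith
      calc (D : ℝ) * (z + 1) ≤ D * (3 * a ^ 2) := mul_le_mul_of_nonneg_left hz3 hD0
        _ = 3 * D * a ^ 2 := by ring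
    rw [← hsq, hKf]
    linarith
  -- assembly
  set X : ℝ := (N : ℝ) / Real.log N ^ k with hX
  have hX0 : 0 ≤ X := by positivity
  set V : ℝ := ∏ p ∈ Nat.primesBelow ⌈z⌉₊, (1 - (polyRootCountMod ![F] p : ℝ) / p) with hVdef
  have hNV : (1 + CFL) * N * V ≤ (1 + CFL) * N * (2 * C * ((8 * A₁) ^ k / Real.log N ^ k)) :=
    mul_le_mul_of_nonneg_left hV (by positivity)
  have hre : (1 + CFL) * N * (2 * C * ((8 * A₁) ^ k / Real.log N ^ k)) =
      (1 + CFL) * 2 * (8 * A₁) ^ k * C * X := by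
    rw [hX]; ring
  have hmainN : (polyPrimeCount f N : ℝ) ≤ B₀ * C * X := by
    have : (polyPrimeCount f N : ℝ) ≤ (1 + CFL) * 2 * (8 * A₁) ^ k * C * X + C * X := by
      linarith
    rw [hB₀]
    linarith
  have hfin : B₀ * C * X ≤ B₀ * C * (cLi * LFunctions.offsetLogIntegralPow k N) :=
    mul_le_mul_of_nonneg_left h4 (by positivity)
  calc (polyPrimeCount f N : ℝ) ≤ B₀ * C * (cLi * LFunctions.offsetLogIntegralPow k N) :=
        hmainN.trans hfin
    _ = B₀ * cLi * (∏ i, (d i : ℝ)) * C / (∏ i, (d i : ℝ)) *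
          LFunctions.offsetLogIntegralPow k N := by
        field_simp

end Literature.NumberTheory.Sieve
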